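import Summits.HubbardSuperconductivity.HubbardSuperconductivity.Statement
import Summits.HubbardSuperconductivity.HubbardSuperconductivity.Theorems.NoGoNogoThesis
import Literature.Barriers.HubbardSuperconductivity.PureModelStripeCompetition
import Literature.MathematicalPhysics.QuantumLattice.PairCorrelationsProofs
import Literature.MathematicalPhysics.QuantumLattice.HubbardRingPerronFrobeniusProofs
import Literature.MathematicalPhysics.QuantumLattice.SectorSpectrum
import Literature.MathematicalPhysics.QuantumLattice.HubbardHubbardModelEtaPairingProofs
import HarnessLib

/-!
# HubbardLadder — rungs R3/R4: certified pair-correlator windows, the finite dichotomy, and the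
two thermodynamic-limit chains (cell `pub-hubbard`, seat `r3`)

HONEST FRAMING: ladder R1–R4 with certified numbers; no claim on H/H₀.

This file TYPES the certificate shapes of rungs R3 and R4 of the cell's ladder (`LADDER.md`) and
PROVES the two elementary thermodynamic-limit chains that turn uniform-in-`L` certificates into
order / disorder statements. Nothing here is a certificate and nothing here claims the cell's
targets `H₀` / `H` (typed in the sibling file `Targets.lean`) or the summit
`HubbardSuperconductivity`: every theorem is an implication `certificate ⇒ statement`, the
certificate shapes are `structure`s carrying the certified numbers that nobody has instantiated,
and no statement is introduced as a fact.

The targets, verbatim (cell brief / `TARGETS.md`):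

* `H` = "the Hubbard dichotomy at `U/t = 8`, hole doping `1/8`: NO `d`-wave off-diagonal
  long-range order for `t' = 0` versus `d`-wave ODLRO for `t'/t ≈ -0.25`."
* `R3` = "A finite-distance dichotomy on large tori (certified separation of the `t' = 0` and
  `t'/t ≈ -0.25` pair correlators at fixed distances/sizes)."
* `R4` = "Thermodynamic-limit order/disorder statements."

## Conventions (inherited from the tree; cell `OBSERVABLES.md` §5)

* A HAMILTONIAN FAMILY is any `H : ∀ L, Matrix …` on the fermionic Fock spaces of the tori
  `(ℤ/Lℤ)²` (`TorusHamiltonianFamily`); the pure model is `pureHubbard U L = hubbardTorus 2 L 1 U`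
  (`t = 1`, `t' = 0`) [cite: QinEtAl2020, §II eq. (1)]; the `t–t'` model of the positive half of
  `H` is `Targets.lean`'s `hubbardTorusTT'` (instance `fun L => hubbardTorusTT' L 1 t' 8`). Every
  statement below is generic in the family, so it serves both halves of `H` unchanged.
* Filling `electronNumber δ L = 2⌊(1-δ)L²/2⌋` in the `S^z = 0` sector (the summit's clause; hole
  doping exactly `1/8` iff `4 ∣ L`); "ground state" = `IsGroundStateInSector (H L) (N L) 0 ψ` with
  `star ψ ⬝ᵥ ψ = 1`, and EVERY such state is quantified over (degenerate ground spaces allowed) —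
  this is what a relaxation certificate bounds and what the summit asks.
* `avgPairCorr L r ψ = L⁻² Σ_x Re ⟨ψ, Δ_x† Δ_{x+r} ψ⟩`, `Δ_x = localPair dWaveFormFactor L x`, the
  translation-averaged `d_{x²-y²}` pair–pair correlator at lattice displacement `r ∈ ℤ²` (`P_d(r)`
  of [cite: QinEtAl2020, §II eqs. (2)–(4)] / `Φ(r)` of [cite: XuEtAl2024, §II] up to the form-factor
  normalisation `±1/√2` of [cite: Scalapino1995, §2 eq. (2.4)]); `pairFieldDensity L ψ =
  L⁻⁴ Re ⟨ψ, Δ† Δ ψ⟩`, `Δ = Σ_x Δ_x`. By `lroSeq_succ_eq_pairFieldDensity`, the `k`-th term of the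
  summit's LRO sequence (`Targets.lean`'s `dWaveOrderParamSq ψ k`) is `pairFieldDensity (2k) (ψ (2k))`
  for `k ≥ 1`.

## Contents

* §0 vocabulary: `TorusHamiltonianFamily`, `pureHubbard`, `electronNumber`, `avgPairCorr`,
  `pairFieldDensity`, `pairFieldDensity_nonneg`, `lroSeq_succ_eq_pairFieldDensity`,
  `exists_groundStateSeq_pure` (the hypothesis clause is never vacuous for the pure model).
* §1 rung R3: `PairCorrWindowCert H N L r` (ONE certified window `lo ≤ P̄_d(L, r; ψ) ≤ hi` valid for
  every normalised sector ground state of `H L`) and `FiniteDichotomyCert H⁻ H⁺ N L r` (numbers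
  `a < b`, `|P̄_d| ≤ a` for every ground state of `H⁻ L`, `b ≤ P̄_d` for every ground state of
  `H⁺ L`); `FiniteDichotomyCert.ofWindows`, `FiniteDichotomyCert.separates`. The cell's R3 instance
  is `FiniteDichotomyCert (pureHubbard 8) (fun L => hubbardTorusTT' L 1 (-1/4) 8) (electronNumber
  (1/8)) L r`, `4 ∣ L`, `r` at distance `≥ 2`; a constructed term reads "certified: at `L, r`,
  `P̄_d^{t'=0}(r) ≤ a < b ≤ P̄_d^{t'=-1/4}(r)`"; two intersecting windows read "brackets overlap: no
  dichotomy certified at this size". Both are results.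
* §2 rung R4: `UniformPairFieldLowerCert H N` (a floor `c > 0` under the pair-field density of every
  sector ground state, uniform in the even sides `L ≥ L₀`) and
  `UniformPairFieldLowerCert.hasLongRangeOrder` (PROVED: every admissible ground-state sequence then
  has the summit's `d`-wave pair-field LRO); `VanishingPairFieldCeilingCert H N` (ceilings
  `u L → 0`) with `VanishingPairFieldCeilingCert.tendsto_zero_lroSeq` (PROVED: the order parameter of
  every admissible sequence tends to `0` — the shape of `Targets.lean`'s `NoDWaveOrderPureU8Eighth`)
  and `.not_hasLongRangeOrder`. The two edges that say what such certificates WOULD decide: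
  `hubbardSuperconductivity_of_uniformLowerCert` (pure model, admissible `(U, δ)` ⇒ the summit) and
  `pureModelStripeCompetition_of_vanishingCeilingCert` (pure model at `(8, 1/8)` ⇒ the catalogued
  open conjecture `PureModelStripeCompetition`). No certificate of either shape exists; the cell's
  inherited energy window at `(U, n) = (8, 7/8)` is `0.365 t` per site wide (`LADDER.md`), orders of
  magnitude above the `10⁻³–10⁻⁴` scale of the long-distance pair correlators in print
  [cite: QinEtAl2020, §III.B Fig. 9] [cite: XuEtAl2024, Fig. 5].

A thermodynamic-limit statement needs bounds UNIFORM IN `L` (translation-invariant /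
infinite-volume relaxations, or an inequality chain valid at every size): that is the entire content
of §2, and a finite list of single-size R3 certificates implies nothing at `L = ∞`.

## Not here (targets for provers; cell `R4-MEMO.md`)

* the summable-envelope step: `P̄_d(L, r; ψ) ≤ F(r)` for all even `L ≥ L₀`, all `r` in the
  fundamental domain `‖r‖_∞ ≤ L/2` and all sector ground states, with `F ∈ ℓ¹(ℤ²)`, gives a
  `VanishingPairFieldCeilingCert` with `u L = ‖F‖₁ / L²` (needs `pairFieldDensity L ψ =
  L⁻² Σ_{r ∈ (ℤ/Lℤ)²} P̄_d(L, r; ψ)`);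
* the soundness theorem of the observable-window SDP device (cell `OBSERVABLES.md` §7) producing
  `PairCorrWindowCert` rows — the analogue for `⟨Δ_x† Δ_y⟩` of the tree's energy-window soundness
  theorems — uniform in `L` for support-box certificates;
* the one-line corollaries onto `Targets.lean`'s `@[conjecture]` targets once that file is in the
  tree (`VanishingPairFieldCeilingCert (pureHubbard 8) (electronNumber (1/8)) → NoDWaveOrderPureU8Eighth`,
  `UniformPairFieldLowerCert (fun L => hubbardTorusTT' L 1 (-1/4) 8) (electronNumber (1/8)) →
  DWaveOrderTPrimeQuarterU8Eighth`).
-/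

namespace Summit.HubbardSuperconductivity.HubbardLadder

open Matrix Finset Filter Literature.Probability.LatticeModels
  Literature.MathematicalPhysics.QuantumLattice
open scoped ComplexOrder Topology

noncomputable section

/-! ## §0 Vocabulary -/

/-- A family of Hamiltonians, one on the fermionic Fock space of each torus `(ℤ/Lℤ)²`; the pure
Hubbard model `pureHubbard U` and the `t–t'` model `fun L => hubbardTorusTT' L t t' U` are the
cell's instances. [folklore] -/
abbrev TorusHamiltonianFamily : Type :=
  ∀ L : ℕ, Matrix (Finset (Orb (FermionTorus 2 L))) (Finset (Orb (FermionTorus 2 L))) ℂ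

/-- The pure square-lattice Hubbard model (`t = 1`, `t' = 0`, coupling `U`) on the tori:
`hubbardTorus 2 L 1 U`. [cite: QinEtAl2020, §II eq. (1)] -/
def pureHubbard (U : ℝ) : TorusHamiltonianFamily := fun L => hubbardTorus 2 L 1 U

/-- The summit's electron number at hole doping `δ` on the `L × L` torus, `2⌊(1-δ)L²/2⌋`.
[cite: ArovasBergKivelsonRaghu2022, §9] -/
def electronNumber (δ : ℝ) (L : ℕ) : ℕ := 2 * ⌊(1 - δ) * (L : ℝ) ^ 2 / 2⌋₊

/-- The translation-averaged `d_{x²-y²}` pair–pair correlator at lattice displacement `r ∈ ℤ²` on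
the `L × L` torus, `P̄_d(L, r; ψ) = L⁻² Σ_x Re ⟨ψ, Δ_x† Δ_{x+r} ψ⟩` (`r` reduced mod `L`; junk
value `0` at side `0`). [cite: QinEtAl2020, §II eqs. (2)–(4)] [cite: Scalapino1995, §2 eq. (2.4)] -/
def avgPairCorr : (L : ℕ) → Site 2 → Fock (Orb (FermionTorus 2 L)) → ℝ
  | 0, _, _ => 0
  | L + 1, r, ψ =>
      (∑ x : TorusSite 2 (L + 1),
          (expect ((localPair dWaveFormFactor (L + 1) x)ᴴ *
              localPair dWaveFormFactor (L + 1) (x + Torus.proj (L + 1) r)) ψ).re) /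
        ((L + 1 : ℕ) : ℝ) ^ 2

/-- The `d_{x²-y²}` pair-field density `p_d(L; ψ) = L⁻⁴ Re ⟨ψ, Δ† Δ ψ⟩`, `Δ = Σ_x Δ_x` (junk value
`0` at side `0`). [cite: Scalapino1995, §2 eq. (2.4)] -/
def pairFieldDensity : (L : ℕ) → Fock (Orb (FermionTorus 2 L)) → ℝ
  | 0, _ => 0
  | L + 1, ψ =>
      (expect ((pairField dWaveFormFactor (L + 1))ᴴ * pairField dWaveFormFactor (L + 1)) ψ).re /
        ((L + 1 : ℕ) : ℝ) ^ 4

/-- `p_d(L; ψ) ≥ 0` (`⟨ψ, Δ† Δ ψ⟩ = ‖Δ ψ‖²`). [folklore] -/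
theorem pairFieldDensity_nonneg (L : ℕ) (ψ : Fock (Orb (FermionTorus 2 L))) :
    0 ≤ pairFieldDensity L ψ := by
  cases L with
  | zero => simp [pairFieldDensity]
  | succ L =>
    simp only [pairFieldDensity]
    refine div_nonneg ?_ (by positivity)
    rw [PosSemidefTrace.expect_conjTranspose_mul]
    exact (Complex.nonneg_iff.mp (dotProduct_star_self_nonneg _)).1

/-- The term of side `L + 1` of the summit's LRO sequence (the pulled-back pair-field two-point
function summed over the fundamental domain `halfOpenBox 2 (L+1)`, normalised by `|Λ|²`) is the
pair-field density `p_d(L+1; ψ_{L+1})` (tree: `torusLROSeq_pairFieldCorr_succ`).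
[cite: Scalapino1995, §2 eq. (2.4)] -/
theorem lroSeq_succ_eq_pairFieldDensity (ψ : ∀ L, Fock (Orb (FermionTorus 2 L))) (L : ℕ) :
    (∑ x ∈ halfOpenBox 2 (L + 1), ∑ y ∈ halfOpenBox 2 (L + 1),
        torusPullback (pairFieldCorr dWaveFormFactor ψ) (L + 1) x y) /
      ((#(halfOpenBox 2 (L + 1)) : ℝ)) ^ 2 = pairFieldDensity (L + 1) (ψ (L + 1)) :=
  torusLROSeq_pairFieldCorr_succ dWaveFormFactor ψ L

/-- Normalised sector ground states of the pure model exist on every torus at every doping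
`δ ≥ -1` (finite-dimensional spectral theory in the sector, `szSector_groundState`, then
normalisation): the hypothesis clause of the order / disorder statements is never vacuous.
Lieb, PRL 62 (1989) 1201, proof of Thm 1. [folklore] -/
theorem exists_groundStateSeq_pure (U δ : ℝ) (hδ : -1 ≤ δ) :
    ∃ ψ : ∀ L, Fock (Orb (FermionTorus 2 L)), ∀ L, Even L →
      star (ψ L) ⬝ᵥ ψ L = 1 ∧ IsGroundStateInSector (pureHubbard U L) (electronNumber δ L) 0 (ψ L) := by
  -- the tree's `NoGo.exists_unit_groundStateInSector_hubbardTorus` (route NoGo, Theorems file),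
  -- side by side, with `NoGo.floor_pairNumber_le` for the capacity check
  choose ψ hψ using fun L : ℕ =>
    NoGo.exists_unit_groundStateInSector_hubbardTorus L 1 U (NoGo.floor_pairNumber_le δ hδ L)
  exact ⟨ψ, fun L _ => hψ L⟩

/-! ## §1 Rung R3 — certified pair-correlator windows and the finite dichotomy -/

/-- **R3 certificate shape, one row.** A certified two-sided window for the translation-averaged
`d`-wave pair correlator at displacement `r` on the `L × L` torus, valid for EVERY normalised
ground state of `H L` in the sector `(N L, S^z = 0)` — what a moment / RDM relaxation with an
energy window delivers (cell `OBSERVABLES.md` §7), and more than one computed ground state gives.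
[cite: QinEtAl2020, §II eqs. (2)–(4)] -/
structure PairCorrWindowCert (H : TorusHamiltonianFamily) (N : ℕ → ℕ) (L : ℕ) (r : Site 2) where
  /-- certified lower end of the window -/
  lo : ℝ
  /-- certified upper end of the window -/
  hi : ℝ
  /-- soundness: every normalised sector ground state has its correlator in the window -/
  sound : ∀ ψ : Fock (Orb (FermionTorus 2 L)), star ψ ⬝ᵥ ψ = 1 →
    IsGroundStateInSector (H L) (N L) 0 ψ → lo ≤ avgPairCorr L r ψ ∧ avgPairCorr L r ψ ≤ hi

/-- **R3 — the finite-distance dichotomy at `(L, r)`.** Certified numbers `a < b` with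
`|P̄_d(L, r; ψ)| ≤ a` for every normalised sector ground state `ψ` of `H⁻ L` and `b ≤ P̄_d(L, r; ψ)`
for every normalised sector ground state of `H⁺ L`. [cite: QinEtAl2020, §III.B]
[cite: XuEtAl2024, §II] -/
structure FiniteDichotomyCert (Hneg Hpos : TorusHamiltonianFamily) (N : ℕ → ℕ) (L : ℕ)
    (r : Site 2) where
  /-- certified ceiling of `|P̄_d|` on the disordered side -/
  a : ℝ
  /-- certified floor of `P̄_d` on the ordered side -/
  b : ℝ
  a_lt_b : a < b
  abs_le_of_neg : ∀ ψ : Fock (Orb (FermionTorus 2 L)), star ψ ⬝ᵥ ψ = 1 →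
    IsGroundStateInSector (Hneg L) (N L) 0 ψ → |avgPairCorr L r ψ| ≤ a
  le_of_pos : ∀ ψ : Fock (Orb (FermionTorus 2 L)), star ψ ⬝ᵥ ψ = 1 →
    IsGroundStateInSector (Hpos L) (N L) 0 ψ → b ≤ avgPairCorr L r ψ

namespace FiniteDichotomyCert

variable {Hneg Hpos : TorusHamiltonianFamily} {N : ℕ → ℕ} {L : ℕ} {r : Site 2}

/-- A finite dichotomy separates the two ground-state manifolds by the value of one correlator.
[folklore] -/
theorem separates (cert : FiniteDichotomyCert Hneg Hpos N L r)
    {ψneg ψpos : Fock (Orb (FermionTorus 2 L))}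
    (hneg₁ : star ψneg ⬝ᵥ ψneg = 1) (hneg₂ : IsGroundStateInSector (Hneg L) (N L) 0 ψneg)
    (hpos₁ : star ψpos ⬝ᵥ ψpos = 1) (hpos₂ : IsGroundStateInSector (Hpos L) (N L) 0 ψpos) :
    avgPairCorr L r ψneg < avgPairCorr L r ψpos :=
  ((le_abs_self _).trans (cert.abs_le_of_neg ψneg hneg₁ hneg₂)).trans_lt
    (cert.a_lt_b.trans_le (cert.le_of_pos ψpos hpos₁ hpos₂))

/-- Assembly of the dichotomy from two certified windows (one per Hamiltonian) that do not overlap,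
`max(|lo⁻|, |hi⁻|) < lo⁺`; when they do overlap the result line is "brackets overlap".
[folklore] -/
def ofWindows (wneg : PairCorrWindowCert Hneg N L r) (wpos : PairCorrWindowCert Hpos N L r)
    (h : max |wneg.lo| |wneg.hi| < wpos.lo) : FiniteDichotomyCert Hneg Hpos N L r where
  a := max |wneg.lo| |wneg.hi|
  b := wpos.lo
  a_lt_b := h
  abs_le_of_neg ψ h₁ h₂ := by
    obtain ⟨hlo, hhi⟩ := wneg.sound ψ h₁ h₂
    exact abs_le_max_abs_abs hlo hhi
  le_of_pos ψ h₁ h₂ := (wpos.sound ψ h₁ h₂).1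

end FiniteDichotomyCert

/-! ## §2 Rung R4 — uniform-in-`L` certificates and the two thermodynamic-limit chains -/

/-- **R4⁺ certificate shape.** A floor `c > 0` under the pair-field density of EVERY normalised
sector ground state, uniform in the even sides `L ≥ L₀` — what a translation-invariant
(infinite-volume) relaxation LOWER bound, or an inequality chain valid at every size, must supply.
[cite: Scalapino1995, §2 eq. (2.4)] -/
structure UniformPairFieldLowerCert (H : TorusHamiltonianFamily) (N : ℕ → ℕ) where
  /-- the uniform floor -/
  c : ℝ
  /-- the side from which it holds -/
  L₀ : ℕ
  c_pos : 0 < c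
  bound : ∀ L, L₀ ≤ L → Even L → ∀ ψ : Fock (Orb (FermionTorus 2 L)), star ψ ⬝ᵥ ψ = 1 →
    IsGroundStateInSector (H L) (N L) 0 ψ → c ≤ pairFieldDensity L ψ

/-- **R4⁺ chain (proved).** A uniform lower certificate gives the summit's `d`-wave pair-field LRO
for EVERY admissible ground-state sequence of the family: the `k`-th term of the LRO sequence is
`p_d(2k; ψ_{2k}) ≥ c` for `2k ≥ L₀`, and the terms are `≤ C_d²` for normalised states
(`pairFieldCorr_succ_le`, which keeps the real `liminf` off its junk value), so `liminf ≥ c > 0`.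
[cite: FriedliVelenik2017, §3.7.2 Definition 3.27] -/
theorem UniformPairFieldLowerCert.hasLongRangeOrder {H : TorusHamiltonianFamily} {N : ℕ → ℕ}
    (cert : UniformPairFieldLowerCert H N) (ψ : ∀ L, Fock (Orb (FermionTorus 2 L)))
    (hψ : ∀ L, Even L → star (ψ L) ⬝ᵥ ψ L = 1 ∧ IsGroundStateInSector (H L) (N L) 0 (ψ L)) :
    HasLongRangeOrder (fun k => halfOpenBox 2 (2 * k))
      (fun k => torusPullback (pairFieldCorr dWaveFormFactor ψ) (2 * k)) := by
  show 0 < liminf (fun k : ℕ =>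
    (∑ x ∈ halfOpenBox 2 (2 * k), ∑ y ∈ halfOpenBox 2 (2 * k),
        torusPullback (pairFieldCorr dWaveFormFactor ψ) (2 * k) x y) /
      ((#(halfOpenBox 2 (2 * k)) : ℝ)) ^ 2) atTop
  set Cd : ℝ := (∑ e ∈ insert 0 unitSteps, ‖((dWaveFormFactor e / Real.sqrt 2 : ℝ) : ℂ)‖ * 2)
    with hCd
  have hup : ∀ᶠ k : ℕ in atTop,
      (∑ x ∈ halfOpenBox 2 (2 * k), ∑ y ∈ halfOpenBox 2 (2 * k),
          torusPullback (pairFieldCorr dWaveFormFactor ψ) (2 * k) x y) /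
        ((#(halfOpenBox 2 (2 * k)) : ℝ)) ^ 2 ≤ Cd ^ 2 := by
    refine eventually_atTop.2 ⟨1, fun k hk => ?_⟩
    obtain ⟨m, hm⟩ : ∃ m, 2 * k = m + 1 := ⟨2 * k - 1, by omega⟩
    have hnorm : star (ψ (2 * k)) ⬝ᵥ ψ (2 * k) = 1 := (hψ (2 * k) (even_two_mul k)).1
    rw [hm] at hnorm ⊢
    rw [torusLROSeq_pairFieldCorr_succ, ← sum_pairFieldCorr_succ, div_le_iff₀ (by positivity)]
    calc ∑ x : TorusSite 2 (m + 1), ∑ y, pairFieldCorr dWaveFormFactor ψ (m + 1) x y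
        ≤ ∑ x : TorusSite 2 (m + 1), ∑ y : TorusSite 2 (m + 1), Cd ^ 2 :=
          Finset.sum_le_sum fun x _ => Finset.sum_le_sum fun y _ =>
            pairFieldCorr_succ_le dWaveFormFactor ψ m hnorm x y
      _ = Cd ^ 2 * ((m + 1 : ℕ) : ℝ) ^ 4 := by
          simp only [Finset.sum_const, Finset.card_univ, Fintype.card_pi, ZMod.card,
            Finset.prod_const, Fintype.card_fin, nsmul_eq_mul]
          push_cast
          ring
  have hev : ∀ᶠ k : ℕ in atTop, cert.c ≤
      (∑ x ∈ halfOpenBox 2 (2 * k), ∑ y ∈ halfOpenBox 2 (2 * k),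
          torusPullback (pairFieldCorr dWaveFormFactor ψ) (2 * k) x y) /
        ((#(halfOpenBox 2 (2 * k)) : ℝ)) ^ 2 := by
    refine eventually_atTop.2 ⟨cert.L₀ + 1, fun k hk => ?_⟩
    obtain ⟨m, hm⟩ : ∃ m, 2 * k = m + 1 := ⟨2 * k - 1, by omega⟩
    have hb := cert.bound (2 * k) (by omega) (even_two_mul k) (ψ (2 * k))
      (hψ (2 * k) (even_two_mul k)).1 (hψ (2 * k) (even_two_mul k)).2
    rw [hm] at hb ⊢
    rwa [lroSeq_succ_eq_pairFieldDensity]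
  exact cert.c_pos.trans_le (le_liminf_of_le (isCoboundedUnder_ge_of_eventually_le _ hup) hev)

/-- **What an R4⁺ certificate for the PURE model would decide**: a uniform lower certificate for
`pureHubbard U` at an admissible `(U, δ)` (`U > 0`, `0 < δ < 1/2`) proves the summit
`HubbardSuperconductivity` outright. (No such certificate exists; this is the edge, not a claim.)
[cite: ArovasBergKivelsonRaghu2022, §9] -/
theorem hubbardSuperconductivity_of_uniformLowerCert {U δ : ℝ} (hU : 0 < U)
    (hδ : δ ∈ Set.Ioo (0 : ℝ) (1 / 2))
    (cert : UniformPairFieldLowerCert (pureHubbard U) (electronNumber δ)) :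
    _root_.HubbardSuperconductivity := by
  refine ⟨U, hU, δ, hδ, fun N ψ hNψ => cert.hasLongRangeOrder ψ fun L hL => ⟨(hNψ L hL).2.1, ?_⟩⟩
  have hgs := (hNψ L hL).2.2
  rw [(hNψ L hL).1] at hgs
  exact hgs

/-- **R4⁻ certificate shape.** Ceilings `u L` over the pair-field density of EVERY normalised
sector ground state on the even sides `L ≥ L₀`, with `u L → 0` — e.g. `u L = ‖F‖₁ / L²` from a
summable translation-invariant envelope `P̄_d(L, r) ≤ F(r)` (an infinite-volume relaxation UPPER
bound on the two-point function). [cite: QinEtAl2020, §III.B] -/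
structure VanishingPairFieldCeilingCert (H : TorusHamiltonianFamily) (N : ℕ → ℕ) where
  /-- the ceilings -/
  u : ℕ → ℝ
  /-- the side from which they hold -/
  L₀ : ℕ
  tendsto_zero : Tendsto u atTop (𝓝 0)
  bound : ∀ L, L₀ ≤ L → Even L → ∀ ψ : Fock (Orb (FermionTorus 2 L)), star ψ ⬝ᵥ ψ = 1 →
    IsGroundStateInSector (H L) (N L) 0 ψ → pairFieldDensity L ψ ≤ u L

/-- **R4⁻ chain (proved).** Under a vanishing ceiling certificate the finite-volume order parameter
of EVERY admissible ground-state sequence tends to `0` (squeezed between `0`, by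
`pairFieldDensity_nonneg`, and `u(2k) → 0`) — the shape of `Targets.lean`'s `NoDWaveOrderPureU8Eighth`.
[cite: FriedliVelenik2017, §3.7.2 Definition 3.27] -/
theorem VanishingPairFieldCeilingCert.tendsto_zero_lroSeq {H : TorusHamiltonianFamily} {N : ℕ → ℕ}
    (cert : VanishingPairFieldCeilingCert H N) (ψ : ∀ L, Fock (Orb (FermionTorus 2 L)))
    (hψ : ∀ L, Even L → star (ψ L) ⬝ᵥ ψ L = 1 ∧ IsGroundStateInSector (H L) (N L) 0 (ψ L)) :
    Tendsto (fun k : ℕ =>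
      (∑ x ∈ halfOpenBox 2 (2 * k), ∑ y ∈ halfOpenBox 2 (2 * k),
          torusPullback (pairFieldCorr dWaveFormFactor ψ) (2 * k) x y) /
        ((#(halfOpenBox 2 (2 * k)) : ℝ)) ^ 2) atTop (𝓝 0) := by
  have h2k : Tendsto (fun k : ℕ => 2 * k) atTop atTop :=
    tendsto_atTop_mono (fun k => Nat.le_mul_of_pos_left k two_pos) tendsto_id
  refine squeeze_zero' ?_ ?_ (cert.tendsto_zero.comp h2k)
  · refine eventually_atTop.2 ⟨1, fun k hk => ?_⟩
    obtain ⟨m, hm⟩ : ∃ m, 2 * k = m + 1 := ⟨2 * k - 1, by omega⟩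
    rw [hm, lroSeq_succ_eq_pairFieldDensity]
    exact pairFieldDensity_nonneg _ _
  · refine eventually_atTop.2 ⟨cert.L₀ + 1, fun k hk => ?_⟩
    obtain ⟨m, hm⟩ : ∃ m, 2 * k = m + 1 := ⟨2 * k - 1, by omega⟩
    have hb := cert.bound (2 * k) (by omega) (even_two_mul k) (ψ (2 * k))
      (hψ (2 * k) (even_two_mul k)).1 (hψ (2 * k) (even_two_mul k)).2
    show _ ≤ cert.u (2 * k)
    rw [hm] at hb ⊢
    rwa [lroSeq_succ_eq_pairFieldDensity]

/-- **R4⁻ chain, LRO form (proved).** A vanishing ceiling certificate excludes the summit's `d`-wave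
pair-field LRO for EVERY admissible ground-state sequence (`liminf = lim = 0`).
[cite: FriedliVelenik2017, §3.7.2 Definition 3.27] -/
theorem VanishingPairFieldCeilingCert.not_hasLongRangeOrder {H : TorusHamiltonianFamily}
    {N : ℕ → ℕ} (cert : VanishingPairFieldCeilingCert H N) (ψ : ∀ L, Fock (Orb (FermionTorus 2 L)))
    (hψ : ∀ L, Even L → star (ψ L) ⬝ᵥ ψ L = 1 ∧ IsGroundStateInSector (H L) (N L) 0 (ψ L)) :
    ¬ HasLongRangeOrder (fun k => halfOpenBox 2 (2 * k))
        (fun k => torusPullback (pairFieldCorr dWaveFormFactor ψ) (2 * k)) := by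
  intro hLRO
  have h : 0 < liminf (fun k : ℕ =>
      (∑ x ∈ halfOpenBox 2 (2 * k), ∑ y ∈ halfOpenBox 2 (2 * k),
          torusPullback (pairFieldCorr dWaveFormFactor ψ) (2 * k) x y) /
        ((#(halfOpenBox 2 (2 * k)) : ℝ)) ^ 2) atTop := hLRO
  rw [(cert.tendsto_zero_lroSeq ψ hψ).liminf_eq] at h
  exact lt_irrefl _ h

/-- **What an R4⁻ certificate for the pure model at `(8, 1/8)` would decide**: the catalogued OPEN
CONJECTURE `PureModelStripeCompetition = ¬ HasDWavePairFieldLROAt 8 (1/8)` ("not every admissible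
sequence has LRO" — ground-state sequences exist, `exists_groundStateSeq_pure`, and none has LRO).
(No such certificate exists; this is the edge, not a claim.) [cite: QinEtAl2020, §IV p. 11] -/
theorem pureModelStripeCompetition_of_vanishingCeilingCert
    (cert : VanishingPairFieldCeilingCert (pureHubbard 8) (electronNumber (1 / 8))) :
    Literature.Barriers.HubbardSuperconductivity.PureModelStripeCompetition := by
  intro hAt
  obtain ⟨ψ, hψ⟩ := exists_groundStateSeq_pure 8 (1 / 8) (by norm_num)
  exact cert.not_hasLongRangeOrder ψ hψ (hAt (electronNumber (1 / 8)) ψ fun L hL => ⟨rfl, hψ L hL⟩)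

end

end Summit.HubbardSuperconductivity.HubbardLadder
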